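import Mathlib
import Summits.Ventures.PercRepro.TriangleCapUpperZoneBelow
import Summits.Ventures.PercRepro.TriangleCapUpperZoneAt
import Summits.Ventures.PercRepro.TriangleCapUpperZoneAbove

/-!
# PercRepro — THE UPPER REGIME ONE BELOW ITS THRESHOLD: THE LOWER BOUND ON ALL GRAPHS (p3, gen 57; part 338)

`D + 1 ≤ 2 r`, `ρ = D − r ≥ 2`, `X = D − 2 ρ`, `m = D + r − 3`, `t = m D + r`.  Every graph of the band has
`t (t − 1) + min(2 r (D − r), 2 ρ (X + 1) + E) ≤ 2 j + 2 t (D − 1)` with `E = 2 X − 2` in the wide regime `X ≥ 2`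
(`upper_zone_bound_wide`) and `E = 4 ρ − 2` (so `2 ρ (X + 1) + E = 4 D − 6`) in the tight regime `X = 1`
(`upper_zone_bound_tight`): no inside edge gives the bipartite value `2 φ_D(r)` (part 311); `1 ≤ I ≤ ρ − 1` is
part 335, `I = ρ` part 336, `I = ρ + 1` in the tight regime part 337, and beyond the abstract residue value of
part 334 already exceeds the target.  Axioms: standard.
-/

namespace PercRepro

namespace TriangleCap

namespace C047

open Finset

variable {V : Type*} [Fintype V] [DecidableEq V]

/-- The surplus of part 335 at `X = 1`: `2 ρ (D − 2 ρ + 1) + 2 (ρ − I)(ρ + I) ≥ 4 D − 6` for `1 ≤ I ≤ ρ − 1`,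
`D = 2 ρ + 1`. -/
theorem tight_below_arith (D r I : ℕ) (h1 : D + 1 = 2 * r) (h2 : r + 2 ≤ D) (hIρ : I + 1 ≤ D - r) :
    4 * D - 6 ≤ 2 * ((D - r) * (D - 2 * (D - r) + 1)) + (2 * (D - 2 * (D - r)) - 2) +
      2 * ((D - r - I) * (D - r + I)) := by
  obtain ⟨ρ, rfl⟩ : ∃ ρ, D = r + ρ := ⟨D - r, by omega⟩
  have hr : r = ρ + 1 := by omega
  subst hr
  obtain ⟨k, rfl⟩ : ∃ k, ρ = I + 1 + k := ⟨ρ - I - 1, by omega⟩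
  have e1 : I + 1 + k + 1 + (I + 1 + k) - (I + 1 + k + 1) = I + 1 + k := by omega
  have e2 : I + 1 + k + 1 + (I + 1 + k) - 2 * (I + 1 + k) + 1 = 2 := by omega
  have e3 : 2 * (I + 1 + k + 1 + (I + 1 + k) - 2 * (I + 1 + k)) - 2 = 0 := by omega
  have e4 : I + 1 + k - I = k + 1 := by omega
  have e5 : 4 * (I + 1 + k + 1 + (I + 1 + k)) - 6 = 8 * I + 8 * k + 6 := by omega
  rw [e1, e2, e3, e4, e5]
  nlinarith [Nat.zero_le (I * k), Nat.zero_le (k * k)]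

/-- **THE LOWER BOUND ONE BELOW THE THRESHOLD, WIDE REGIME `D ≥ 2 ρ + 2`:** for `D + 2 ≤ 2 r`, `r + 2 ≤ D`,
`m + 3 = D + r`, `t = m D + r`, every triangle-free `H` with `s` edges, `w` of degree `s − t ≥ 1`, every off-degree
`≤ D`, at the band value `2 j` has
`t (t − 1) + min(2 r (D − r), 2 ρ (D − 2 ρ + 1) + (2 (D − 2 ρ) − 2)) ≤ 2 j + 2 t (D − 1)`, `ρ = D − r`. -/
theorem upper_zone_bound_wide (H : SimpleGraph V) [DecidableRel H.Adj] (hfree : H.CliqueFree 3) (s m r D j : ℕ)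
    (h1 : D + 2 ≤ 2 * r) (h2 : r + 2 ≤ D) (hm : m + 3 = D + r) (hs : H.edgeFinset.card = s) (w : V)
    (hw : deg H w + (m * D + r) = s) (hw1 : 1 ≤ deg H w)
    (hj : ∑ v, deg H v * deg H v + 2 * ((m * D + r) * (s - (m * D + r) - 1)) + 2 * j = s * (s + 1))
    (hD : ∀ v, offDeg H w v ≤ D) :
    (m * D + r) * (m * D + r - 1) +
        min (2 * (r * (D - r))) (2 * ((D - r) * (D - 2 * (D - r) + 1)) + (2 * (D - 2 * (D - r)) - 2)) ≤
      2 * j + 2 * ((m * D + r) * (D - 1)) := by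
  have hD0 : 0 < D := by omega
  have hphi := band_ge_phi H hfree s (m * D + r) j D hs w hw hw1 hj hD
  have hoff : (offEdges H w).card = m * D + r := by
    have := card_offEdges_add_deg H w
    omega
  have hIt : (insideEdges H w).card ≤ m * D + r := by
    have := attach_add_card_inside H hfree w
    omega
  rcases Nat.eq_zero_or_pos (insideEdges H w).card with hI0 | hI1
  · -- no inside edge: the bipartite value
    rw [hI0, mul_zero, add_zero, Nat.sub_zero, add_zero] at hphi
    have hp : phiD D (m * D + r) = r * (D - r) := by
      rw [show m * D + r = D * m + r by ring, phiD_mul_add, phiD_of_lt D r (by omega)]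
    rw [hp] at hphi
    have : 2 * (r * (D - r)) = r * (D - r) + r * (D - r) := by ring
    have := min_le_left (2 * (r * (D - r)))
      (2 * ((D - r) * (D - 2 * (D - r) + 1)) + (2 * (D - 2 * (D - r)) - 2))
    omega
  refine le_trans (Nat.add_le_add_left (min_le_right _ _) _) ?_
  rcases Nat.lt_or_ge (insideEdges H w).card (D - r) with hlt | hge
  · -- `1 ≤ I ≤ ρ − 1`
    have := upper_zone_I_lt H hfree s m r D j (by omega) h2 hm hs w hw hw1 hj hD hI1 (by omega)
    omega
  rcases Nat.eq_or_lt_of_le hge with heq | hgt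
  · -- `I = ρ`
    have := (upper_zone_I_eq H hfree s m r D j (by omega) h2 hm hs w hw hw1 hj hD heq.symm).1
    omega
  · -- `I ≥ ρ + 1`: the abstract residue value
    have habs := residue_upper_one_below_wide m (D - r) (2 * r - D) (insideEdges H w).card (by omega) (by omega)
      (by omega) (by
        have e1 : 2 * (D - r) + (2 * r - D) = D := by omega
        have e2 : D - r + (2 * r - D) = r := by omega
        rw [e1, e2]
        exact hIt)
    have e1 : 2 * (D - r) + (2 * r - D) = D := by omega
    have e2 : D - r + (2 * r - D) = r := by omega
    rw [e1, e2] at habs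
    have e3 : D - 2 * (D - r) = 2 * r - D := by omega
    rw [e3]
    have e4 : 2 * ((D - r) * (2 * r - D + 1)) = 2 * (D - r) * (2 * r - D + 1) := by ring
    rw [e4]
    omega

/-- **THE LOWER BOUND ONE BELOW THE THRESHOLD, TIGHT REGIME `D = 2 ρ + 1`:** for `D + 1 = 2 r`, `r + 2 ≤ D`,
`m + 3 = D + r`, `t = m D + r`, every triangle-free `H` with `s` edges, `w` of degree `s − t ≥ 1`, every off-degree
`≤ D`, at the band value `2 j` has `t (t − 1) + min(2 r (D − r), 4 D − 6) ≤ 2 j + 2 t (D − 1)`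
(`4 D − 6 = 2 ρ (D − 2 ρ + 1) + 4 ρ − 2`). -/
theorem upper_zone_bound_tight (H : SimpleGraph V) [DecidableRel H.Adj] (hfree : H.CliqueFree 3) (s m r D j : ℕ)
    (h1 : D + 1 = 2 * r) (h2 : r + 2 ≤ D) (hm : m + 3 = D + r) (hs : H.edgeFinset.card = s) (w : V)
    (hw : deg H w + (m * D + r) = s) (hw1 : 1 ≤ deg H w)
    (hj : ∑ v, deg H v * deg H v + 2 * ((m * D + r) * (s - (m * D + r) - 1)) + 2 * j = s * (s + 1))
    (hD : ∀ v, offDeg H w v ≤ D) :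
    (m * D + r) * (m * D + r - 1) + min (2 * (r * (D - r))) (4 * D - 6) ≤
      2 * j + 2 * ((m * D + r) * (D - 1)) := by
  have hD0 : 0 < D := by omega
  have hphi := band_ge_phi H hfree s (m * D + r) j D hs w hw hw1 hj hD
  have hoff : (offEdges H w).card = m * D + r := by
    have := card_offEdges_add_deg H w
    omega
  have hIt : (insideEdges H w).card ≤ m * D + r := by
    have := attach_add_card_inside H hfree w
    omega
  rcases Nat.eq_zero_or_pos (insideEdges H w).card with hI0 | hI1
  · rw [hI0, mul_zero, add_zero, Nat.sub_zero, add_zero] at hphi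
    have hp : phiD D (m * D + r) = r * (D - r) := by
      rw [show m * D + r = D * m + r by ring, phiD_mul_add, phiD_of_lt D r (by omega)]
    rw [hp] at hphi
    have : 2 * (r * (D - r)) = r * (D - r) + r * (D - r) := by ring
    have := min_le_left (2 * (r * (D - r))) (4 * D - 6)
    omega
  refine le_trans (Nat.add_le_add_left (min_le_right _ _) _) ?_
  rcases Nat.lt_or_ge (insideEdges H w).card (D - r) with hlt | hge
  · -- `1 ≤ I ≤ ρ − 1`
    have := upper_zone_I_lt H hfree s m r D j (by omega) h2 hm hs w hw hw1 hj hD hI1 (by omega)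
    have := tight_below_arith D r (insideEdges H w).card h1 h2 (by omega)
    omega
  rcases Nat.eq_or_lt_of_le hge with heq | hgt
  · -- `I = ρ`
    have := (upper_zone_I_eq H hfree s m r D j (by omega) h2 hm hs w hw hw1 hj hD heq.symm).2 h1
    omega
  rcases Nat.eq_or_lt_of_le hgt with heq' | hgt'
  · -- `I = ρ + 1 = r`
    exact upper_zone_I_succ_tight H hfree s m r D j h1 h2 hm hs w hw hw1 hj hD (by omega)
  · -- `I ≥ ρ + 2`: the abstract residue value
    have habs := residue_upper_one_below_tight m (D - r) (insideEdges H w).card (by omega) (by omega) (by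
        have e1 : 2 * (D - r) + 1 = D := by omega
        have e2 : D - r + 1 = r := by omega
        rw [e1, e2]
        exact hIt)
    have e1 : 2 * (D - r) + 1 = D := by omega
    have e2 : D - r + 1 = r := by omega
    rw [e1, e2] at habs
    omega

end C047

end TriangleCap

end PercRepro
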